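import Literature.NumberTheory.Automorphic.InfUnitaryFactorialBoundOfIrrep       -- ★ FB head `upq_factorialBound_of_isIrreducibleGK` (p835016) via ★ `InfUnitary.factorialBound`'s file
import Literature.NumberTheory.Automorphic.DiscreteAutomorphicRepArchModule      -- ★ generic `inner_dπ_add_inner_dπ_eq_zero` (dϖ skew-Hermitian for unitary ϖ)
import Literature.NumberTheory.Automorphic.UnitaryGroupArchCharacter             -- ★ `IsUnitaryGlobalization`
import Literature.Analysis.OperatorTheory.OneParameterAnalyticVector             -- ★ `analyticAt_oneParam_apply_of_norm_le`
import HarnessLib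

/-!
# The Harish-Chandra vectors of a unitary globalization of an irreducible `(𝔤, K)`-class of `U(p,q)` are ANALYTIC along every
# one-parameter subgroup (Harish-Chandra 1953 §9 «well-behaved vectors», via the tree's factorial bound (FB))

Topic `NumberTheory/Automorphic`; namespace `Literature.NumberTheory.Automorphic`.  THEOREMS ONLY (no definition, no instance, no notation, no
named fact, no `sorry`).  Cell `hodgecm-mathlib`, F0∕P3, ROAD «TF» §3 T5(b) («HC Thm 8 hard half»), FILE 2 of 3: the analyticity hypotheses `hana`,
`hana'` of ★ `HilbertRepIsometricLieIntertwinerExtension.areUnitarilyEquivalent_of_isometricLieIntertwiner_of_dense` for the Harish-Chandra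
spaces of two unitary globalizations.

THE MATHEMATICS ([HarishChandra1953, §9 (Lemma 34 and the proof of Thm. 8)]; [Nelson1959, §2]; [KnappVogan1995, Thm. 0.6]).  Let `G = U(α, β)`
(★ `uFormGroup α β`), `x` an irreducible `(𝔤, K)`-class and `ϖ` a UNITARY GLOBALIZATION of `x` on the Hilbert space `E` (★ `IsUnitaryGlobalization`:
unitary, strongly continuous, Harish-Chandra module `H_K^∞(ϖ) = smoothVectors ⊓ kFiniteVectors` `(𝔤, K)`-equivalent to `x`).  The Harish-Chandra
module `(H_K^∞(ϖ), ϖ|_K, dϖ)` is an irreducible `(𝔤, K)`-module (★ `IsUnitaryGlobalization.isIrreducibleGK_harishChandra`) carrying the RESTRICTED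
INNER PRODUCT of `E`, which is positive definite Hermitian, `K`-invariant (unitarity) and `𝔤`-skew (★ `inner_dπ_add_inner_dπ_eq_zero`).  Hence the
tree's FACTORIAL BOUND (FB) ★ `upq_factorialBound_of_isIrreducibleGK` (Casimir scalar by Dixmier ★ `exists_upqCasimirOp_harishChandra_eq_smul`, a
generating `K`-type by `K`-finiteness) applies to it, with the completion norm `‖emb v‖` EQUAL to `‖v‖_E` (★ `IsPosDefHerm.norm_emb_sq`):
**`‖dϖ(X₁) ⋯ dϖ(X_m) v‖ ≤ C_v · m! · K^m · ∏ ‖X_i‖`** (§2), in particular `‖dϖ(X)^m v‖ ≤ C_v · m! · (K‖X‖)^m`.  Since `t ↦ ϖ(exp tX)` is a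
norm-preserving one-parameter group with `d/dt|₀ ϖ(exp tX) (dϖ(X)^k v) = dϖ(X)^{k+1} v` (★ `hasDerivAt_dπ`), the orbit `t ↦ ϖ(exp tX) v` of every
`v ∈ H_K^∞(ϖ)` is REAL ANALYTIC at every `t₀` as an `E`-valued map (★ `Literature.Analysis.OperatorTheory.analyticAt_oneParam_apply_of_norm_le`,
Taylor's formula) (§3), and so is every matrix coefficient `t ↦ ⟪u, ϖ(exp tX) v⟫` (§3).

* §1 `IsUnitaryGlobalization.isPosDefHerm_innerForm_harishChandra` — the restricted inner product as an ★ `IsPosDefHerm` form on `H_K^∞(ϖ)`, with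
  `‖emb v‖ = ‖v‖`, `K`-invariance and `𝔤`-skewness in the (FB) currency.
* §2 **`IsUnitaryGlobalization.factorialBound_harishChandra`** — (FB) on `H_K^∞(ϖ)` in the norm of `E`; `…norm_dπ_pow_le` — the one-direction form.
* §3 **`IsUnitaryGlobalization.analyticAt_expMem_smul_apply`** (strong) and **`…analyticAt_inner_expMem_smul_apply`** (matrix coefficients).

HONEST SCOPE: all signatures `(α, β)` with `α, β` non-empty (the generality of ★ FB); general linear real groups would need Harish-Chandra's Lemma 34
(elliptic regularity), which the tree has only for automorphic forms (★ `KFiniteZFiniteAnalytic`).  HC_CM is proved only modulo the 2 remaining named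
inputs (hLiu418, h413) until rung 0 closes.

## Mathlib ∕ tree search
Tree: ★ `upq_factorialBound_of_isIrreducibleGK` (`UpqInfUnitaryFactorialBound`, p835016), ★ `exists_upqCasimirOp_harishChandra_eq_smul` + ★
`isGKModule_harishChandra_holds` (`GKModulesDixmierSchur` ∕ `GKModulesProofs`), ★ `IsUnitaryGlobalization.isIrreducibleGK_harishChandra`
(`UnitaryGlobalizationIrreducibleNoAdm`), ★ `IsPosDefHerm` ∕ `norm_emb_sq` (`InfUnitaryHilbertCompletion`), ★ `inner_dπ_add_inner_dπ_eq_zero`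
(`DiscreteAutomorphicRepArchModule` §0, generic), ★ `hasDerivAt_dπ` ∕ `coe_harishChandraRepLie_apply` (`GKModulesSmoothVectorsProofs`), ★
`analyticAt_oneParam_apply_of_norm_le` (`Literature/Analysis/OperatorTheory/OneParameterAnalyticVector`), ★ `GKTensor.kOrbitSpan_stable`, ★
`IsGKModule.mem_span_orbit_self`.  Mathlib: `ContinuousLinearMap.analyticAt`, `AnalyticAt.comp`, `innerSL`, `List.ofFn_const`, `List.prod_replicate`,
`Finset.prod_const`.  Dedup: `rg "analyticAt_expMem_smul_apply|factorialBound_harishChandra|isPosDefHerm_innerForm" Literature/ Summits/` — no hits;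
the automorphic-forms analyticity ★ `U21AnalyticVectors` ∕ ★ `F0P3GenOrbitAnalytic` concern `rightRegular`∕`archRep` of `L²`-automorphic forms, not
abstract unitary globalizations.

## References
* Harish-Chandra, *Representations of a semisimple Lie group on a Banach space. I*, Trans. AMS 75 (1953), §9 (Lemma 34; Thm. 8) [HarishChandra1953].
* E. Nelson, *Analytic vectors*, Ann. of Math. 70 (1959), §2 [Nelson1959].
* A. W. Knapp, D. A. Vogan, *Cohomological Induction and Unitary Representations* (1995), Introduction, Thm. 0.6 [KnappVogan1995].
-/

-- Mathlib idiom (Mathlib/Algebra/Lie/OfAssociative.lean; as in ★ `GKModules`): the commutator bracket on `Module.End ℂ V` ∕ `Matrix N N ℂ`, needed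
-- to MENTION `harishChandraRepLie … : 𝔤 →ₗ⁅ℝ⁆ Module.End ℂ _`.
attribute [local instance 100] LieRing.ofAssociativeRing

set_option autoImplicit false

noncomputable section

open scoped InnerProductSpace ComplexConjugate Matrix Matrix.Norms.Operator Nat
open Filter Topology

namespace Literature.NumberTheory.Automorphic

open Literature.RepresentationTheory Literature.RepresentationTheory.KonnoKonno2007 Literature.RepresentationTheory.KonnoKonno2007.RealDualPair
open Literature.RepresentationTheory.BorelWallach2000

variable {α β : Type} [Fintype α] [DecidableEq α] [Fintype β] [DecidableEq β]
  {x : GKIrrClass (uFormGroup α β)}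
  {E : Type} [NormedAddCommGroup E] [InnerProductSpace ℂ E] [CompleteSpace E]
  {ϖ : ContRepresentation ℂ (uFormGroup α β).carrier E}

/-! ## §1 The restricted inner product on `H_K^∞(ϖ)` as a positive definite Hermitian form -/

omit [CompleteSpace E] in
/-- **The restricted inner product of `E` on the Harish-Chandra space is a positive definite Hermitian form** (★ `IsPosDefHerm`) — for the form
`B v w := ⟪v, w⟫_E` written as `((innerₛₗ ℂ).comp ι).compl₂ ι`, `ι` the inclusion `H_K^∞(ϖ) ↪ E`. [cite: KnappVogan1995, Introduction (0.5)] -/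
theorem isPosDefHerm_innerForm_submodule (V₀ : Submodule ℂ E) :
    IsPosDefHerm ((((innerₛₗ ℂ (E := E)).comp V₀.subtype).compl₂ V₀.subtype : V₀ →ₗ⋆[ℂ] V₀ →ₗ[ℂ] ℂ)) := by
  refine ⟨fun v w => ?_, fun v hv => ?_⟩
  · change ⟪(v : E), (w : E)⟫_ℂ = conj ⟪(w : E), (v : E)⟫_ℂ
    exact (inner_conj_symm _ _).symm
  · change 0 < (⟪(v : E), (v : E)⟫_ℂ).re
    rw [inner_self_eq_norm_sq_to_K]
    have hv' : (v : E) ≠ 0 := fun h => hv (Submodule.coe_eq_zero.mp h)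
    have h : (0 : ℝ) < ‖(v : E)‖ ^ 2 := by positivity
    exact_mod_cast h

omit [CompleteSpace E] in
/-- The completion norm of the restricted inner-product form IS the norm of `E`: `‖emb v‖ = ‖v‖` (★ `IsPosDefHerm.norm_emb_sq`).
[cite: KnappVogan1995, Introduction (0.5)] -/
theorem norm_emb_innerForm_submodule (V₀ : Submodule ℂ E) (v : V₀) :
    ‖(isPosDefHerm_innerForm_submodule V₀).emb v‖ = ‖(v : E)‖ := by
  have h := (isPosDefHerm_innerForm_submodule V₀).norm_emb_sq v
  have h' : ((((innerₛₗ ℂ (E := E)).comp V₀.subtype).compl₂ V₀.subtype : V₀ →ₗ⋆[ℂ] V₀ →ₗ[ℂ] ℂ) v v).re = ‖(v : E)‖ ^ 2 := by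
    change (⟪(v : E), (v : E)⟫_ℂ).re = ‖(v : E)‖ ^ 2
    rw [inner_self_eq_norm_sq_to_K]
    norm_cast
  rw [h'] at h
  exact (pow_left_inj₀ (norm_nonneg _) (norm_nonneg _) two_ne_zero).mp h

/-- **`K`-invariance** of the restricted form on `H_K^∞(ϖ)` for unitary `ϖ`: `⟪ϖ(k) v, ϖ(k) w⟫ = ⟪v, w⟫` (★ `IsUnitary.inner_map_map`).
[cite: BorelWallach2000, 0 §2.5] -/
theorem innerForm_harishChandraRepK (hu : ϖ.IsUnitary) (k : (uFormGroup α β).maximalCompact)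
    (v w : harishChandraSpace (uFormGroup α β) ϖ) :
    (((innerₛₗ ℂ (E := E)).comp (harishChandraSpace (uFormGroup α β) ϖ).subtype).compl₂ (harishChandraSpace (uFormGroup α β) ϖ).subtype)
        (harishChandraRepK (uFormGroup α β) ϖ k v) (harishChandraRepK (uFormGroup α β) ϖ k w) =
      (((innerₛₗ ℂ (E := E)).comp (harishChandraSpace (uFormGroup α β) ϖ).subtype).compl₂ (harishChandraSpace (uFormGroup α β) ϖ).subtype) v w := by
  change ⟪((harishChandraRepK (uFormGroup α β) ϖ k v : harishChandraSpace (uFormGroup α β) ϖ) : E),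
      ((harishChandraRepK (uFormGroup α β) ϖ k w : harishChandraSpace (uFormGroup α β) ϖ) : E)⟫_ℂ = ⟪(v : E), (w : E)⟫_ℂ
  rw [coe_harishChandraRepK_apply, coe_harishChandraRepK_apply]
  exact hu.inner_map_map _ _ _

/-- **`𝔤`-skewness** of the restricted form on `H_K^∞(ϖ)` for unitary `ϖ`: `⟪dϖ(Y) v, w⟫ = −⟪v, dϖ(Y) w⟫` (★ `inner_dπ_add_inner_dπ_eq_zero`).
[cite: BorelWallach2000, 0 §2.5] -/
theorem innerForm_harishChandraRepLie (hu : ϖ.IsUnitary) (hc : ϖ.IsStronglyContinuous) (Y : (uFormGroup α β).lie)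
    (v w : harishChandraSpace (uFormGroup α β) ϖ) :
    (((innerₛₗ ℂ (E := E)).comp (harishChandraSpace (uFormGroup α β) ϖ).subtype).compl₂ (harishChandraSpace (uFormGroup α β) ϖ).subtype)
        (harishChandraRepLie (uFormGroup α β) ϖ hc Y v) w =
      -(((innerₛₗ ℂ (E := E)).comp (harishChandraSpace (uFormGroup α β) ϖ).subtype).compl₂ (harishChandraSpace (uFormGroup α β) ϖ).subtype)
        v (harishChandraRepLie (uFormGroup α β) ϖ hc Y w) := by
  change ⟪((harishChandraRepLie (uFormGroup α β) ϖ hc Y v : harishChandraSpace (uFormGroup α β) ϖ) : E), (w : E)⟫_ℂ =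
    -⟪(v : E), ((harishChandraRepLie (uFormGroup α β) ϖ hc Y w : harishChandraSpace (uFormGroup α β) ϖ) : E)⟫_ℂ
  rw [coe_harishChandraRepLie_apply, coe_harishChandraRepLie_apply]
  exact inner_dπ_left_eq_neg (uFormGroup α β) ϖ hu v.2.1 w.2.1 Y

/-! ## §2 The factorial bound (FB) on the Harish-Chandra space of a unitary globalization, in the norm of `E` -/

/-- **(FB) ON `H_K^∞(ϖ)` FOR A UNITARY GLOBALIZATION `ϖ` OF AN IRREDUCIBLE `(𝔤, K)`-CLASS OF `U(α, β)`**, in the norm of `E`: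
`∃ K ≥ 0, ∀ v ∈ H_K^∞(ϖ), ∃ C, ∀ m (X : Fin m → 𝔤), ‖dϖ(X₀) ⋯ dϖ(X_{m−1}) v‖ ≤ C · m! · K^m · ∏ ‖X_i‖` (★ `upq_factorialBound_of_isIrreducibleGK` for the
`(𝔤, K)`-module `(H_K^∞(ϖ), ϖ|_K, dϖ)` — ★ `isGKModule_harishChandra_holds`, ★ `isIrreducibleGK_harishChandra` — with the restricted inner product (§1),
the Casimir scalar of ★ `exists_upqCasimirOp_harishChandra_eq_smul` and the `K`-span of a non-zero vector as generating `K`-type; `‖emb v‖ = ‖v‖`).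
[cite: HarishChandra1953, §9] [cite: Nelson1959, §2] [cite: KnappVogan1995, Thm. 0.6] -/
theorem IsUnitaryGlobalization.factorialBound_harishChandra [Nonempty α] [Nonempty β] (hϖ : IsUnitaryGlobalization (uFormGroup α β) x ϖ) :
    ∃ K : ℝ, 0 ≤ K ∧ ∀ v : harishChandraSpace (uFormGroup α β) ϖ, ∃ C : ℝ, ∀ (m : ℕ) (X : Fin m → (uFormGroup α β).lie),
      ‖(((List.ofFn fun i => (harishChandraRepLie (uFormGroup α β) ϖ hϖ.isStronglyContinuous (X i) :
            Module.End ℂ (harishChandraSpace (uFormGroup α β) ϖ))).prod v : harishChandraSpace (uFormGroup α β) ϖ) : E)‖ ≤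
        C * m ! * K ^ m * ∏ i, ‖((X i : (uFormGroup α β).lie) : Matrix (α ⊕ β) (α ⊕ β) ℂ)‖ := by
  -- the `(𝔤, K)`-module `H_K^∞(ϖ)`
  set ρK := harishChandraRepK (uFormGroup α β) ϖ with hρK
  set ρ𝔤 := harishChandraRepLie (uFormGroup α β) ϖ hϖ.isStronglyContinuous with hρ𝔤
  have hV : IsGKModule (uFormGroup α β) ρK ρ𝔤 :=
    isGKModule_harishChandra_holds (uFormGroup α β) ϖ hϖ.isStronglyContinuous ρK (fun _ _ => rfl)
      (isHarishChandraModuleOf_harishChandraRepLie (uFormGroup α β) ϖ hϖ.isStronglyContinuous)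
  have hirr : IsIrreducibleGK ρK ρ𝔤 := hϖ.isIrreducibleGK_harishChandra (uFormGroup α β)
  -- the restricted inner product
  have hB := isPosDefHerm_innerForm_submodule (harishChandraSpace (uFormGroup α β) ϖ)
  have hskew := innerForm_harishChandraRepLie hϖ.isUnitary hϖ.isStronglyContinuous
  have hKu := innerForm_harishChandraRepK hϖ.isUnitary
  -- Casimir scalar (Dixmier)
  obtain ⟨c, hc⟩ := exists_upqCasimirOp_harishChandra_eq_smul hϖ
  -- a generating `K`-type: the `K`-span of a non-zero vector
  haveI := hirr.nontrivial
  obtain ⟨v₀, hv₀⟩ := exists_ne (0 : harishChandraSpace (uFormGroup α β) ϖ)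
  let W₀ : Submodule ℂ (harishChandraSpace (uFormGroup α β) ϖ) := Submodule.span ℂ (Set.range fun k : (uFormGroup α β).maximalCompact => ρK k v₀)
  haveI : FiniteDimensional ℂ W₀ := hV.kFinite v₀
  have hW₀K : ∀ (k : (uFormGroup α β).maximalCompact), ∀ w ∈ W₀, ρK k w ∈ W₀ := fun k w hw =>
    GKTensor.kOrbitSpan_stable (uFormGroup α β) ρK v₀ k hw
  have hW₀ne : W₀ ≠ ⊥ := fun h => hv₀ ((Submodule.eq_bot_iff _).mp h v₀ (IsGKModule.mem_span_orbit_self v₀))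
  obtain ⟨K, hK, hFB⟩ := upq_factorialBound_of_isIrreducibleGK ρK ρ𝔤 hV hirr hB hskew hKu hc W₀ hW₀K hW₀ne
  refine ⟨K, hK, fun v => ?_⟩
  obtain ⟨C, hC⟩ := hFB v
  refine ⟨C, fun m X => ?_⟩
  rw [← norm_emb_innerForm_submodule]
  exact hC m X

/-- `List.ofFn` of a constant function has product the power. [folklore] -/
private theorem prod_ofFn_const {M : Type*} [Monoid M] (a : M) (m : ℕ) : (List.ofFn fun _ : Fin m => a).prod = a ^ m := by
  rw [List.ofFn_const, List.prod_replicate]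

/-- **(FB) along one direction**: `∃ K ≥ 0, ∀ v ∈ H_K^∞(ϖ), ∃ C, ∀ m X, ‖dϖ(X)^m v‖ ≤ C · m! · (K‖X‖)^m` (all `X_i := X` in
`factorialBound_harishChandra`). [cite: HarishChandra1953, §9] [cite: Nelson1959, §2] -/
theorem IsUnitaryGlobalization.norm_dπ_pow_le [Nonempty α] [Nonempty β] (hϖ : IsUnitaryGlobalization (uFormGroup α β) x ϖ) :
    ∃ K : ℝ, 0 ≤ K ∧ ∀ v : harishChandraSpace (uFormGroup α β) ϖ, ∃ C : ℝ, ∀ (m : ℕ) (X : (uFormGroup α β).lie),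
      ‖((((harishChandraRepLie (uFormGroup α β) ϖ hϖ.isStronglyContinuous X : Module.End ℂ (harishChandraSpace (uFormGroup α β) ϖ)) ^ m) v :
          harishChandraSpace (uFormGroup α β) ϖ) : E)‖ ≤
        C * m ! * (K * ‖((X : (uFormGroup α β).lie) : Matrix (α ⊕ β) (α ⊕ β) ℂ)‖) ^ m := by
  obtain ⟨K, hK, h⟩ := hϖ.factorialBound_harishChandra
  refine ⟨K, hK, fun v => ?_⟩
  obtain ⟨C, hC⟩ := h v
  refine ⟨C, fun m X => ?_⟩
  have h1 := hC m (fun _ => X)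
  rw [prod_ofFn_const, Finset.prod_const, Finset.card_univ, Fintype.card_fin] at h1
  calc _ ≤ C * m ! * K ^ m * ‖((X : (uFormGroup α β).lie) : Matrix (α ⊕ β) (α ⊕ β) ℂ)‖ ^ m := h1
    _ = C * m ! * (K * ‖((X : (uFormGroup α β).lie) : Matrix (α ⊕ β) (α ⊕ β) ℂ)‖) ^ m := by rw [mul_pow]; ring

/-! ## §3 Analyticity of the orbits and of the matrix coefficients -/

omit [CompleteSpace E] in
/-- `ϖ(exp ((s+t)X)) = ϖ(exp (sX)) ∘ ϖ(exp (tX))` (one-parameter law; ★ `RealMatrixGroup.expMem_add_smul`, re-derived to keep imports light). [folklore] -/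
private theorem apply_expMem_add_smul' (X : (uFormGroup α β).lie) (s t : ℝ) (v : E) :
    ϖ ((uFormGroup α β).expMem ((s + t) • X)) v = ϖ ((uFormGroup α β).expMem (s • X)) (ϖ ((uFormGroup α β).expMem (t • X)) v) := by
  have h : (uFormGroup α β).expMem ((s + t) • X) = (uFormGroup α β).expMem (s • X) * (uFormGroup α β).expMem (t • X) := by
    refine Subtype.ext ?_
    change expGL (((s + t) • X : (uFormGroup α β).lie) : Matrix (α ⊕ β) (α ⊕ β) ℂ) =
      expGL ((s • X : (uFormGroup α β).lie) : Matrix (α ⊕ β) (α ⊕ β) ℂ) * expGL ((t • X : (uFormGroup α β).lie) : Matrix (α ⊕ β) (α ⊕ β) ℂ)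
    exact expGL_add_smul s t (X : Matrix (α ⊕ β) (α ⊕ β) ℂ)
  rw [h, map_mul]
  rfl

/-- **THE ORBIT `t ↦ ϖ(exp tX) v` OF A HARISH-CHANDRA VECTOR OF A UNITARY GLOBALIZATION IS REAL ANALYTIC** at every `t₀ ∈ ℝ`, as an
`E`-valued map (★ `analyticAt_oneParam_apply_of_norm_le` with `U t = ϖ(exp tX)` norm-preserving, `w_k = dϖ(X)^k v`, `d/dt|₀ U t w_k = w_{k+1}` by ★
`hasDerivAt_dπ`, and `‖w_k‖ ≤ C · (K‖X‖)^k · k!` by §2). [cite: HarishChandra1953, §9 (Lemma 34, Thm. 8)] [cite: Nelson1959, §2] -/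
theorem IsUnitaryGlobalization.analyticAt_expMem_smul_apply [Nonempty α] [Nonempty β] (hϖ : IsUnitaryGlobalization (uFormGroup α β) x ϖ)
    {v : E} (hv : v ∈ harishChandraSpace (uFormGroup α β) ϖ) (X : (uFormGroup α β).lie) (t₀ : ℝ) :
    AnalyticAt ℝ (fun t : ℝ => ϖ ((uFormGroup α β).expMem (t • X)) v) t₀ := by
  obtain ⟨K, hK, h⟩ := hϖ.norm_dπ_pow_le
  obtain ⟨C, hC⟩ := h ⟨v, hv⟩
  -- the derivative sequence `w k = dϖ(X)^k v`
  let L : Module.End ℂ (harishChandraSpace (uFormGroup α β) ϖ) := harishChandraRepLie (uFormGroup α β) ϖ hϖ.isStronglyContinuous X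
  let w : ℕ → E := fun k => (((L ^ k) ⟨v, hv⟩ : harishChandraSpace (uFormGroup α β) ϖ) : E)
  have hw0 : w 0 = v := by simp [w]
  have hw : ∀ k, HasDerivAt (fun t : ℝ => ((ϖ ((uFormGroup α β).expMem (t • X))).restrictScalars ℝ) (w k)) (w (k + 1)) 0 := by
    intro k
    have hmem : w k ∈ harishChandraSpace (uFormGroup α β) ϖ := ((L ^ k) ⟨v, hv⟩).2
    have hd := hasDerivAt_dπ (uFormGroup α β) ϖ (differentiableAt_of_mem_smoothVectors (uFormGroup α β) ϖ hmem.1) X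
    have heq : w (k + 1) = dπ (uFormGroup α β) ϖ (w k) X := by
      change (((L ^ (k + 1)) ⟨v, hv⟩ : harishChandraSpace (uFormGroup α β) ϖ) : E) = _
      rw [pow_succ', Module.End.mul_apply]
      exact coe_harishChandraRepLie_apply (uFormGroup α β) ϖ hϖ.isStronglyContinuous X _
    rw [heq]
    exact hd
  have hb : ∀ k, ‖w k‖ ≤ C * (K * ‖((X : (uFormGroup α β).lie) : Matrix (α ⊕ β) (α ⊕ β) ℂ)‖) ^ k * k ! := fun k => by
    have h1 := hC k X
    calc ‖w k‖ ≤ C * k ! * (K * ‖((X : (uFormGroup α β).lie) : Matrix (α ⊕ β) (α ⊕ β) ℂ)‖) ^ k := h1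
      _ = C * (K * ‖((X : (uFormGroup α β).lie) : Matrix (α ⊕ β) (α ⊕ β) ℂ)‖) ^ k * k ! := by ring
  have hU : ∀ (s t : ℝ) (u : E), ((ϖ ((uFormGroup α β).expMem ((s + t) • X))).restrictScalars ℝ) u =
      ((ϖ ((uFormGroup α β).expMem (s • X))).restrictScalars ℝ) (((ϖ ((uFormGroup α β).expMem (t • X))).restrictScalars ℝ) u) :=
    fun s t u => apply_expMem_add_smul' X s t u
  have hBd : ∀ (t : ℝ) (u : E), ‖((ϖ ((uFormGroup α β).expMem (t • X))).restrictScalars ℝ) u‖ ≤ 1 * ‖u‖ := fun t u => by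
    rw [one_mul, ContinuousLinearMap.coe_restrictScalars', hϖ.isUnitary.norm_map]
  have han := Literature.Analysis.OperatorTheory.analyticAt_oneParam_apply_of_norm_le
    (fun t : ℝ => (ϖ ((uFormGroup α β).expMem (t • X))).restrictScalars ℝ) hU hBd w hw hb t₀
  rw [hw0] at han
  exact han

/-- **EVERY MATRIX COEFFICIENT `t ↦ ⟪u, ϖ(exp tX) v⟫` OF A HARISH-CHANDRA VECTOR OF A UNITARY GLOBALIZATION IS REAL ANALYTIC** at every `t₀`
(composition of the analytic orbit with the continuous linear functional `⟪u, ·⟫`) — the hypothesis `hana` of ★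
`areUnitarilyEquivalent_of_isometricLieIntertwiner_of_dense` for `S = H_K^∞(ϖ)`. [cite: HarishChandra1953, §9 (Lemma 34, Thm. 8)] [cite: Nelson1959, §2] -/
theorem IsUnitaryGlobalization.analyticAt_inner_expMem_smul_apply [Nonempty α] [Nonempty β] (hϖ : IsUnitaryGlobalization (uFormGroup α β) x ϖ)
    {v : E} (hv : v ∈ harishChandraSpace (uFormGroup α β) ϖ) (u : E) (X : (uFormGroup α β).lie) (t₀ : ℝ) :
    AnalyticAt ℝ (fun t : ℝ => ⟪u, ϖ ((uFormGroup α β).expMem (t • X)) v⟫_ℂ) t₀ := by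
  have h := hϖ.analyticAt_expMem_smul_apply hv X t₀
  have hL : AnalyticAt ℝ (fun y : E => ((innerSL ℂ u).restrictScalars ℝ) y) (ϖ ((uFormGroup α β).expMem (t₀ • X)) v) :=
    ((innerSL ℂ u).restrictScalars ℝ).analyticAt _
  exact AnalyticAt.comp (f := fun t : ℝ => ϖ ((uFormGroup α β).expMem (t • X)) v) (x := t₀) hL h

end Literature.NumberTheory.Automorphic

end
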